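import Mathlib
import Summits.NavierStokesRegularity.FluidComputer.AbcClassIIndex
import Summits.NavierStokesRegularity.FluidComputer.AbcClassIISynthesis

/-!
# Class-I layer of the ABC certificate chains, Part X: synthesis of a smooth class-I eigenfamily from
# coordinates on the orbit basis
(profile-cert-3 g9 — F5 implementation-3 seat, cell `ns-blowup`, 2026-08-27; the class-I twin of instab4 g6's
`AbcClassIISynthesis`, same statements and proofs with the class-I basis families)

HONEST FRAMING (human rulings D-0035/D-0074): nothing here is a claim about Navier–Stokes blow-up.
WHAT THIS IS NOT: not NS evidence. MODEL lane (class I). Sequel of `AbcClassIDefs/Symmetry/Basis/Index`.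
A coordinate vector `w : Idx → ℂ` synthesises the family `c(k) = Σ_a w ⟨O_k,a⟩ • bfam ⟨O_k,a⟩ (k)`
(`c(0) = 0`); this file proves: Parseval on each orbit (`sum_norm_sq_orbitExpansion`), the weighted
square sums of `c` are controlled by those of `w` (`sum_weight_norm_sq_le`) hence RAPID DECAY
(`rapidDecay_of_coordinates`, via instab3's `LatticeSqWeightsRapidDecay`), transversality, non-vanishing,
and **`certifier_eigen_of_coordinates`: the coordinate eigen-equation
`−(|O_i|²/R) w_i + Σ_{j ∈ nbrIdx i} amat i j w_j = λ w_i` implies the certifiers' eigen-equation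
`−(|k|²/R) c(k) + Π_k X c(k) = λ c(k)` at every frequency** (locality + class-I completeness on each orbit,
`AbcClassIBasis.eq_zero_of_orthogonal`). The punctured-cube bookkeeping (`AbcClassII.cube_filter_eq_biUnion`,
`sum_cube_filter_eq`, `onormSq_nonneg`) is character-free and used by name.

Mathlib + the files named; no new definitions. bears_on LADDER-NS N5 / Z4-a(1) (CR rows T2/T4).
-/

noncomputable section

open scoped BigOperators ComplexConjugate InnerProductSpace
open Finset MeasureTheory UnitAddTorus

namespace Summit.NavierStokesRegularity.FluidComputer.AbcClassI

open Literature.Analysis.FunctionSpaces Literature.Analysis.FunctionSpaces.Torus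
open Literature.Analysis.FunctionSpaces.EuclideanSpace
open Literature.Analysis.FluidPDE Literature.Analysis.FluidPDE.SteadyLattice
open Literature.Analysis.FluidPDE.ScalarFourier
open Summit.NavierStokesRegularity.FluidComputer.AbcClassII (Fam crossForm secOp rotR rotS sgnAct sgnOrbit
  cube extend restrictTo extend_add extend_smul extend_zero rotR_add rotR_smul rotS_add rotS_smul
  crossForm_add crossForm_smul secOp_add secOp_smul restrictTo_add restrictTo_smul Orbit toOrbit onormSq
  osupNorm cubeOrbits nbrOrbits mem_sgnOrbit mem_sgnOrbit_self card_sgnOrbit_le sgnOrbit_eq_of_mem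
  mem_sgnOrbit_comm sgnOrbit_eq_or_disjoint neg_mem_sgnOrbit neg_self_mem_sgnOrbit rotFreqR_mem_sgnOrbit
  rotFreqS_mem_sgnOrbit freqNormSq_eq_of_mem_sgnOrbit supNorm_eq_of_mem_sgnOrbit mem_cube
  mem_cube_iff_supNorm cube_mono sgnOrbit_subset_cube zero_not_mem_sgnOrbit ne_zero_of_mem_sgnOrbit
  toOrbit_val toOrbit_eq_iff mem_cubeOrbits mem_nbrOrbits mem_nbrOrbits_comm card_nbrOrbits_le rotR_apply
  rotS_apply freqNormSq_rotFreq secOp_conj isConjSymm_secOp kdot_secOp mem_iff_of_orbitClosed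
  isConjSymm_cut kdot_cut orbitClosed_cube_ne_zero orbitClosed_shell neg_mem_of_orbitClosed
  isConjSymm_lerayCrossForm kdot_conj conj_eq_zero_of_not_mem linOp_zero_eq conj_theta_neg
  extend_apply_of_mem extend_apply_of_not_mem restrictTo_extend extend_restrictTo extend_sum
  inner_eq_sum_extend inner_conjVec_conjVec conj_sum_inner_of_isConjSymm sum_inner_eq_re_of_isConjSymm
  real_inner_eq_re real_smul_eq norm_lerayCrossForm_le sobolevWeight_one_eq cube_filter_eq_biUnion sum_cube_filter_eq
  onormSq_nonneg)

/-! ## Part X. Synthesis: from coordinates on the class-I orbit basis to a smooth class-I eigenfamily -/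

section Synthesis

variable {α : Type*}

/-- Finite combinations of basis families, evaluated. -/
theorem sum_smul_bfam_apply (T : Finset α) (g : α → AbcClassI.Idx) (w : α → ℂ) (k : Fin 3 → ℤ) :
    (∑ a ∈ T, w a • AbcClassI.bfam (g a)) k = ∑ a ∈ T, w a • AbcClassI.bfam (g a) k := by
  rw [Finset.sum_apply]; rfl

/-- Finite combinations of basis families are transversal. -/
theorem kdot_sum_smul_bfam (T : Finset α) (g : α → AbcClassI.Idx) (w : α → ℂ) (k : Fin 3 → ℤ) :
    ∑ j : Fin 3, ((k j : ℤ) : ℂ) * (∑ a ∈ T, w a • AbcClassI.bfam (g a)) k j = 0 := by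
  classical
  induction T using Finset.induction_on with
  | empty => simp
  | insert a s ha ih =>
    rw [Finset.sum_insert ha, Pi.add_apply, kdot_add, Pi.smul_apply, kdot_smul, (bfam_spec (g a)).1 k,
      mul_zero, zero_add, ih]

/-- Finite combinations of basis families are class I. -/
theorem isClassI_sum_smul_bfam (T : Finset α) (g : α → AbcClassI.Idx) (w : α → ℂ) :
    IsClassI (∑ a ∈ T, w a • AbcClassI.bfam (g a)) := by
  classical
  induction T using Finset.induction_on with
  | empty => simpa using isClassI_zero
  | insert a s ha ih => rw [Finset.sum_insert ha]; exact ((bfam_spec (g a)).2.1.smul _).add ih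

/-- A finite combination vanishes at the frequencies outside all its orbits. -/
theorem sum_smul_bfam_apply_eq_zero (T : Finset α) (g : α → AbcClassI.Idx) (w : α → ℂ) {k : Fin 3 → ℤ}
    (hk : ∀ a ∈ T, k ∉ (g a).1.1) : (∑ a ∈ T, w a • AbcClassI.bfam (g a)) k = 0 := by
  rw [sum_smul_bfam_apply]
  exact Finset.sum_eq_zero fun a ha => by rw [bfam_apply_of_not_mem (g a) (hk a ha), smul_zero]

/-- `Π_k X` is linear on finite combinations of basis families. -/
theorem lerayCrossForm_sum_smul (T : Finset α) (g : α → AbcClassI.Idx) (w : α → ℂ) (k : Fin 3 → ℤ) :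
    Torus.lerayCoeff k (crossForm 1 1 1 (∑ a ∈ T, w a • AbcClassI.bfam (g a)) k) =
      ∑ a ∈ T, w a • Torus.lerayCoeff k (crossForm 1 1 1 (AbcClassI.bfam (g a)) k) := by
  classical
  induction T using Finset.induction_on with
  | empty =>
    rw [Finset.sum_empty, Finset.sum_empty]
    have : crossForm 1 1 1 (0 : Fam) k = 0 :=
      AbcLatticeLocality.crossForm_eq_zero_of_neighbours 1 1 1 0 k fun s _ => rfl
    rw [this, lerayCoeff_zero_vec]
  | insert a s ha ih =>
    rw [Finset.sum_insert ha, Finset.sum_insert ha, crossForm_add, lerayCoeff_add', crossForm_smul,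
      lerayCoeff_smul', ih]

/-- **Parseval on an orbit**: `Σ_{k∈O} ‖(Σ_a w_a bfam ⟨O,a⟩)(k)‖² = Σ_a |w_a|²`. -/
theorem sum_norm_sq_orbitExpansion (O : Orbit) (w : AbcClassI.Idx → ℂ) :
    ∑ k ∈ O.1, ‖(∑ a : Fin (AbcClassI.odim O), w ⟨O, a⟩ • AbcClassI.bfam ⟨O, a⟩) k‖ ^ 2 = ∑ a : Fin (AbcClassI.odim O), ‖w ⟨O, a⟩‖ ^ 2 := by
  set F : Fam := ∑ a : Fin (odim O), w ⟨O, a⟩ • bfam ⟨O, a⟩ with hF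
  have hcoef : ∀ a : Fin (odim O), w ⟨O, a⟩ = ∑ k ∈ O.1, (inner ℂ (bfam ⟨O, a⟩ k) (F k) : ℂ) :=
    fun a => coeff_eq_sum_inner O (z := fun a => w ⟨O, a⟩) hF a
  have hFk : ∀ k, F k = ∑ a : Fin (odim O), w ⟨O, a⟩ • bfam ⟨O, a⟩ k := fun k => by
    rw [hF, Finset.sum_apply]; rfl
  have h1 : (((∑ k ∈ O.1, ‖F k‖ ^ 2 : ℝ)) : ℂ) = ∑ k ∈ O.1, (inner ℂ (F k) (F k) : ℂ) := by
    push_cast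
    refine Finset.sum_congr rfl fun k _ => ?_
    rw [inner_self_eq_norm_sq_to_K]; rfl
  have h2 : ∑ k ∈ O.1, (inner ℂ (F k) (F k) : ℂ) =
      ∑ a : Fin (odim O), w ⟨O, a⟩ * (starRingEnd ℂ) (w ⟨O, a⟩) := by
    have step : ∀ k, (inner ℂ (F k) (F k) : ℂ) =
        ∑ a : Fin (odim O), w ⟨O, a⟩ * (inner ℂ (F k) (bfam ⟨O, a⟩ k) : ℂ) := by
      intro k
      have e : (inner ℂ (F k) (F k) : ℂ) = inner ℂ (F k) (∑ a : Fin (odim O), w ⟨O, a⟩ • bfam ⟨O, a⟩ k) := by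
        rw [← hFk k]
      rw [e, inner_sum]
      exact Finset.sum_congr rfl fun a _ => by rw [inner_smul_right]
    rw [Finset.sum_congr rfl fun k _ => step k, Finset.sum_comm]
    refine Finset.sum_congr rfl fun a _ => ?_
    rw [← Finset.mul_sum]
    congr 1
    rw [hcoef a, map_sum]
    exact Finset.sum_congr rfl fun k _ => (inner_conj_symm _ _).symm
  have h3 : ∑ a : Fin (odim O), w ⟨O, a⟩ * (starRingEnd ℂ) (w ⟨O, a⟩) =
      (((∑ a : Fin (odim O), ‖w ⟨O, a⟩‖ ^ 2 : ℝ)) : ℂ) := by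
    push_cast
    refine Finset.sum_congr rfl fun a _ => ?_
    rw [Complex.mul_conj, Complex.normSq_eq_norm_sq]; push_cast; rfl
  have := h1.trans (h2.trans h3)
  exact_mod_cast this

/-- Sums over `cubeIdx n` are sums over the orbits of the cube and then over the basis index. -/
theorem sum_cubeIdx_eq (n : ℕ) (f : AbcClassI.Idx → ℝ) :
    ∑ i ∈ AbcClassI.cubeIdx n, f i = ∑ O ∈ cubeOrbits n, ∑ a : Fin (AbcClassI.odim O), f ⟨O, a⟩ :=
  Finset.sum_sigma (cubeOrbits n) (fun O => (Finset.univ : Finset (Fin (odim O)))) (fun i => f i)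

/-- **Weighted square sums of an orbitwise-synthesised family are controlled by the coordinates**:
if `c(k) = (Σ_a w ⟨O,a⟩ bfam ⟨O,a⟩)(k)` on every orbit `O` and `c(0) = 0`, then for every finite set of
frequencies `T`, `Σ_{k∈T} (1+|k|²)^s ‖c k‖² ≤ Σ'_i (1+|O_i|²)^s |w_i|²` (when the right side converges). -/
theorem sum_weight_norm_sq_le (c : Fam) (w : AbcClassI.Idx → ℂ)
    (hc : ∀ O : Orbit, ∀ k ∈ O.1, c k = ∑ a : Fin (AbcClassI.odim O), w ⟨O, a⟩ • AbcClassI.bfam ⟨O, a⟩ k)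
    (hc0 : c 0 = 0) (s : ℕ) (hw : Summable fun i : AbcClassI.Idx => (1 + onormSq i.1) ^ s * ‖w i‖ ^ 2)
    (T : Finset (Fin 3 → ℤ)) :
    ∑ k ∈ T, (1 + freqNormSq k) ^ s * ‖c k‖ ^ 2 ≤ ∑' i : AbcClassI.Idx, (1 + onormSq i.1) ^ s * ‖w i‖ ^ 2 := by
  classical
  set n : ℕ := T.sup AbcClassII.supNorm with hn
  have hT : T ⊆ cube n := fun k hk => mem_cube_iff_supNorm.mpr (Finset.le_sup (f := AbcClassII.supNorm) hk)
  have hg0 : ∀ k, 0 ≤ (1 + freqNormSq k) ^ s * ‖c k‖ ^ 2 := fun k =>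
    mul_nonneg (pow_nonneg (by linarith [freqNormSq_nonneg k]) _) (sq_nonneg _)
  -- enlarge to the punctured cube
  have h1 : ∑ k ∈ T, (1 + freqNormSq k) ^ s * ‖c k‖ ^ 2 ≤
      ∑ k ∈ (cube n).filter (fun k => k ≠ 0), (1 + freqNormSq k) ^ s * ‖c k‖ ^ 2 := by
    have hz : ∑ k ∈ T, (1 + freqNormSq k) ^ s * ‖c k‖ ^ 2 =
        ∑ k ∈ T.filter (fun k => k ≠ 0), (1 + freqNormSq k) ^ s * ‖c k‖ ^ 2 := by
      rw [Finset.sum_filter]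
      refine Finset.sum_congr rfl fun k _ => ?_
      by_cases hk : k ≠ 0
      · rw [if_pos hk]
      · push Not at hk; subst hk
        rw [if_neg (fun h => h rfl), hc0, norm_zero]; ring
    rw [hz]
    exact Finset.sum_le_sum_of_subset_of_nonneg (Finset.filter_subset_filter _ hT) fun k _ _ => hg0 k
  refine h1.trans ?_
  rw [sum_cube_filter_eq]
  -- orbitwise Parseval
  have h2 : ∀ O ∈ cubeOrbits n, ∑ k ∈ O.1, (1 + freqNormSq k) ^ s * ‖c k‖ ^ 2 =
      ∑ a : Fin (odim O), (1 + onormSq O) ^ s * ‖w ⟨O, a⟩‖ ^ 2 := by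
    intro O _
    rw [← Finset.mul_sum, ← sum_norm_sq_orbitExpansion O w, Finset.mul_sum]
    refine Finset.sum_congr rfl fun k hk => ?_
    rw [O.freqNormSq_eq hk, hc O k hk, Finset.sum_apply]
    rfl
  rw [Finset.sum_congr rfl h2, ← sum_cubeIdx_eq n (fun i => (1 + onormSq i.1) ^ s * ‖w i‖ ^ 2)]
  exact Summable.sum_le_tsum (cubeIdx n)
    (fun i _ => mul_nonneg (pow_nonneg (by linarith [onormSq_nonneg i.1]) _) (sq_nonneg _)) hw

/-- **Rapid decay of the synthesised family** from the weighted summability of the coordinates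
(`LatticeSqWeightsRapidDecay.rapidDecay_of_summable_sq_weights`). -/
theorem rapidDecay_of_coordinates (c : Fam) (w : AbcClassI.Idx → ℂ)
    (hc : ∀ O : Orbit, ∀ k ∈ O.1, c k = ∑ a : Fin (AbcClassI.odim O), w ⟨O, a⟩ • AbcClassI.bfam ⟨O, a⟩ k)
    (hc0 : c 0 = 0) (hw : ∀ s : ℕ, Summable fun i : AbcClassI.Idx => (1 + onormSq i.1) ^ s * ‖w i‖ ^ 2) :
    RapidDecay c := by
  refine LatticeSqWeightsRapidDecay.rapidDecay_of_summable_sq_weights fun s => ?_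
  exact summable_of_sum_le (fun k => mul_nonneg (pow_nonneg (by linarith [freqNormSq_nonneg k]) _)
    (sq_nonneg _)) (sum_weight_norm_sq_le c w hc hc0 s (hw s))

/-- The synthesised family is transversal. -/
theorem kdot_of_coordinates (c : Fam) (w : AbcClassI.Idx → ℂ)
    (hc : ∀ O : Orbit, ∀ k ∈ O.1, c k = ∑ a : Fin (AbcClassI.odim O), w ⟨O, a⟩ • AbcClassI.bfam ⟨O, a⟩ k)
    (hc0 : c 0 = 0) (k : Fin 3 → ℤ) : ∑ j : Fin 3, ((k j : ℤ) : ℂ) * c k j = 0 := by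
  by_cases hk : k = 0
  · subst hk; rw [hc0]; simp
  · have h := kdot_sum_smul_bfam Finset.univ (fun a => (⟨toOrbit k hk, a⟩ : Idx)) (fun a => w ⟨toOrbit k hk, a⟩) k
    rw [sum_smul_bfam_apply] at h
    rw [hc (toOrbit k hk) k (mem_sgnOrbit_self k)]
    exact h

/-- The synthesised family is non-zero as soon as one coordinate is. -/
theorem ne_zero_of_coordinates (c : Fam) (w : AbcClassI.Idx → ℂ)
    (hc : ∀ O : Orbit, ∀ k ∈ O.1, c k = ∑ a : Fin (AbcClassI.odim O), w ⟨O, a⟩ • AbcClassI.bfam ⟨O, a⟩ k)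
    {i : AbcClassI.Idx} (hi : w i ≠ 0) : c ≠ 0 := by
  obtain ⟨O, a⟩ := i
  intro h0
  apply hi
  have h := coeff_eq_sum_inner O (z := fun a => w ⟨O, a⟩)
    (c := ∑ a : Fin (odim O), w ⟨O, a⟩ • bfam ⟨O, a⟩) rfl a
  refine h.trans (Finset.sum_eq_zero fun k hk => ?_)
  rw [Finset.sum_apply]
  have e : ∑ a' : Fin (odim O), (w ⟨O, a'⟩ • bfam ⟨O, a'⟩) k = c k := by
    rw [hc O k hk]; rfl
  rw [e, h0, Pi.zero_apply, inner_zero_right]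

/-- On the six neighbours of an orbit, the synthesised family is the finite combination over the
neighbouring orbits. -/
theorem neighbour_value (c : Fam) (w : AbcClassI.Idx → ℂ)
    (hc : ∀ O : Orbit, ∀ k ∈ O.1, c k = ∑ a : Fin (AbcClassI.odim O), w ⟨O, a⟩ • AbcClassI.bfam ⟨O, a⟩ k)
    (hc0 : c 0 = 0) (O : Orbit) {k' s : Fin 3 → ℤ} (hk' : k' ∈ O.1) (hs : s ∈ Torus.abcFreq) :
    c (k' - s) = (∑ j ∈ ((nbrOrbits O).sigma (fun O' => (Finset.univ : Finset (Fin (AbcClassI.odim O')))) : Finset AbcClassI.Idx),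
      w j • AbcClassI.bfam j) (k' - s) := by
  classical
  rw [Finset.sum_apply]
  by_cases hz : k' - s = 0
  · rw [hz, hc0]
    symm
    refine Finset.sum_eq_zero fun j _ => ?_
    show w j • bfam j 0 = 0
    rw [bfam_apply_of_not_mem j (fun h => Orbit.ne_zero_of_mem j.1 h rfl), smul_zero]
  · obtain ⟨O', hmem⟩ : ∃ O' : Orbit, k' - s ∈ O'.1 := ⟨toOrbit (k' - s) hz, mem_sgnOrbit_self _⟩
    have hO'nb : O' ∈ nbrOrbits O := mem_nbrOrbits.mpr ⟨k', hk', s, hs, hmem⟩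
    rw [hc O' (k' - s) hmem]
    have e : (∑ j ∈ ((nbrOrbits O).sigma (fun O'' => (Finset.univ : Finset (Fin (odim O'')))) : Finset Idx),
        (w j • bfam j) (k' - s)) =
        ∑ O'' ∈ nbrOrbits O, ∑ a : Fin (odim O''), w ⟨O'', a⟩ • bfam ⟨O'', a⟩ (k' - s) :=
      Finset.sum_sigma (nbrOrbits O) (fun O'' => (Finset.univ : Finset (Fin (odim O''))))
        (fun j => (w j • bfam j) (k' - s))
    rw [e]
    symm
    rw [Finset.sum_eq_single O']
    · intro O'' _ hne
      refine Finset.sum_eq_zero fun a _ => ?_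
      have hnot : k' - s ∉ O''.1 := fun h =>
        hne (Subtype.ext ((O''.sgnOrbit_eq h).symm.trans (O'.sgnOrbit_eq hmem)))
      rw [bfam_apply_of_not_mem ⟨O'', a⟩ hnot, smul_zero]
    · intro hnot; exact absurd hO'nb hnot

/-- **The residual on one orbit vanishes**: with `F = Σ_a w⟨O,a⟩ bfam⟨O,a⟩`,
`G = Σ_{j ∈ nbrIdx} w_j bfam_j` and `μ = −|O|²/R − λ`, the coordinate equation forces
`μ F(k) + Π_k X G(k) = 0` at every `k ∈ O` (a class-I transversal family supported in `O` and
orthogonal to the basis families of `O` is zero). -/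
theorem residual_eq_zero {R : ℝ} (lam : ℂ) (w : AbcClassI.Idx → ℂ) (O : Orbit)
    (hcoord : ∀ i : AbcClassI.Idx, ((-(onormSq i.1 / R) : ℝ) : ℂ) * w i +
      ∑ j ∈ AbcClassI.nbrIdx i, ((AbcClassI.amat i j : ℝ) : ℂ) * w j = lam * w i)
    (k : Fin 3 → ℤ) (hkO : k ∈ O.1) :
    (((-(onormSq O / R) : ℝ) : ℂ) - lam) • (∑ a : Fin (AbcClassI.odim O), w ⟨O, a⟩ • AbcClassI.bfam ⟨O, a⟩) k +
      Torus.lerayCoeff k (crossForm 1 1 1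
        (∑ j ∈ ((nbrOrbits O).sigma (fun O' => (Finset.univ : Finset (Fin (AbcClassI.odim O')))) : Finset AbcClassI.Idx), w j • AbcClassI.bfam j) k) = 0 := by
  classical
  -- names
  generalize hμ : (((-(onormSq O / R) : ℝ) : ℂ) - lam) = μ
  have hFI : IsClassI (∑ a : Fin (odim O), w ⟨O, a⟩ • bfam ⟨O, a⟩) :=
    isClassI_sum_smul_bfam Finset.univ (fun a => (⟨O, a⟩ : Idx)) fun a => w ⟨O, a⟩
  have hGI : IsClassI (∑ j ∈ ((nbrOrbits O).sigma (fun O' => (Finset.univ : Finset (Fin (odim O')))) : Finset Idx),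
      w j • bfam j) :=
    isClassI_sum_smul_bfam _ (fun j => j) w
  -- the residual family H and its cut to the orbit
  have hHI : IsClassI (μ • (∑ a : Fin (odim O), w ⟨O, a⟩ • bfam ⟨O, a⟩) + fun k' => Torus.lerayCoeff k'
      (crossForm 1 1 1 (∑ j ∈ ((nbrOrbits O).sigma (fun O' => (Finset.univ : Finset (Fin (odim O')))) : Finset Idx),
        w j • bfam j) k')) := (hFI.smul μ).add hGI.lerayCrossForm
  have hHt : ∀ k' : Fin 3 → ℤ, ∑ jj : Fin 3, ((k' jj : ℤ) : ℂ) *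
      (μ • (∑ a : Fin (odim O), w ⟨O, a⟩ • bfam ⟨O, a⟩) + fun k' => Torus.lerayCoeff k'
        (crossForm 1 1 1 (∑ j ∈ ((nbrOrbits O).sigma (fun O' => (Finset.univ : Finset (Fin (odim O')))) : Finset Idx),
          w j • bfam j) k')) k' jj = 0 := by
    intro k'
    rw [Pi.add_apply, kdot_add, Pi.smul_apply, kdot_smul,
      kdot_sum_smul_bfam Finset.univ (fun a => (⟨O, a⟩ : Idx)) (fun a => w ⟨O, a⟩) k', mul_zero, zero_add]
    exact kdot_lerayCoeff _ _
  have hr0 := eq_zero_of_orthogonal O (c := fun k' => if k' ∈ O.1 then (μ • (∑ a : Fin (odim O),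
      w ⟨O, a⟩ • bfam ⟨O, a⟩) + fun k' => Torus.lerayCoeff k' (crossForm 1 1 1
        (∑ j ∈ ((nbrOrbits O).sigma (fun O' => (Finset.univ : Finset (Fin (odim O')))) : Finset Idx), w j • bfam j) k')) k'
      else 0) (fun k' hk' => if_neg hk') (kdot_cut hHt O.1) (hHI.cut O.orbitClosed) ?_
  · have := congrFun hr0 k
    simpa only [if_pos hkO, Pi.zero_apply, Pi.add_apply, Pi.smul_apply] using this
  -- orthogonality = the coordinate equation
  intro a
  have e1 : ∀ k' ∈ O.1, (inner ℂ (bfam ⟨O, a⟩ k') ((fun k' => if k' ∈ O.1 then (μ • (∑ a : Fin (odim O),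
      w ⟨O, a⟩ • bfam ⟨O, a⟩) + fun k' => Torus.lerayCoeff k' (crossForm 1 1 1
        (∑ j ∈ ((nbrOrbits O).sigma (fun O' => (Finset.univ : Finset (Fin (odim O')))) : Finset Idx), w j • bfam j) k')) k'
      else 0) k') : ℂ) =
      μ * (inner ℂ (bfam ⟨O, a⟩ k') ((∑ a : Fin (odim O), w ⟨O, a⟩ • bfam ⟨O, a⟩) k') : ℂ) +
        ∑ j ∈ ((nbrOrbits O).sigma (fun O' => (Finset.univ : Finset (Fin (odim O')))) : Finset Idx),
          w j * (inner ℂ (bfam ⟨O, a⟩ k') (Torus.lerayCoeff k' (crossForm 1 1 1 (bfam j) k')) : ℂ) := by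
    intro k' hk'
    simp only [if_pos hk', Pi.add_apply, Pi.smul_apply, inner_add_right, inner_smul_right]
    have hL := lerayCrossForm_sum_smul
      ((nbrOrbits O).sigma (fun O' => (Finset.univ : Finset (Fin (odim O')))) : Finset Idx) (fun j => j) w k'
    rw [hL, inner_sum]
    congr 1
    exact Finset.sum_congr rfl fun j _ => by rw [inner_smul_right]
  rw [Finset.sum_congr rfl e1, Finset.sum_add_distrib, ← Finset.mul_sum,
    ← coeff_eq_sum_inner O (z := fun a => w ⟨O, a⟩) rfl a, Finset.sum_comm]
  have e3 : ∀ j ∈ ((nbrOrbits O).sigma (fun O' => (Finset.univ : Finset (Fin (odim O')))) : Finset Idx),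
      ∑ k' ∈ O.1, w j * (inner ℂ (bfam ⟨O, a⟩ k') (Torus.lerayCoeff k' (crossForm 1 1 1 (bfam j) k')) : ℂ) =
        ((amat ⟨O, a⟩ j : ℝ) : ℂ) * w j := by
    intro j _
    rw [← Finset.mul_sum, ← amat_eq ⟨O, a⟩ j, mul_comm]
  rw [Finset.sum_congr rfl e3]
  have h := hcoord ⟨O, a⟩
  rw [← hμ]
  change ((-(onormSq O / R) : ℝ) : ℂ) * w ⟨O, a⟩ +
    ∑ j ∈ ((nbrOrbits O).sigma (fun O' => (Finset.univ : Finset (Fin (odim O')))) : Finset Idx),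
      ((amat ⟨O, a⟩ j : ℝ) : ℂ) * w j = lam * w ⟨O, a⟩ at h
  linear_combination h

/-- **The eigen-equation of the certifiers' operator from the eigen-equation in coordinates.** If
`c(k) = Σ_a w ⟨O,a⟩ bfam ⟨O,a⟩ (k)` on every orbit, `c(0) = 0`, and the coordinates solve
`−(|O_i|²/R) w_i + Σ_{j ∈ nbrIdx i} amat i j w_j = λ w_i` for every `i`, then
`−(|k|²/R) c(k) + Π_k X c(k) = λ c(k)` for every `k` (locality: on the orbit of `k` the operator sees only
the finite combination over the neighbouring orbits; completeness on the orbit). -/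
theorem certifier_eigen_of_coordinates {R : ℝ} (lam : ℂ) (c : Fam) (w : AbcClassI.Idx → ℂ)
    (hc : ∀ O : Orbit, ∀ k ∈ O.1, c k = ∑ a : Fin (AbcClassI.odim O), w ⟨O, a⟩ • AbcClassI.bfam ⟨O, a⟩ k)
    (hc0 : c 0 = 0)
    (hcoord : ∀ i : AbcClassI.Idx, ((-(onormSq i.1 / R) : ℝ) : ℂ) * w i +
      ∑ j ∈ AbcClassI.nbrIdx i, ((AbcClassI.amat i j : ℝ) : ℂ) * w j = lam * w i) (k : Fin 3 → ℤ) :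
    ((-(freqNormSq k / R) : ℝ) : ℂ) • c k + Torus.lerayCoeff k (crossForm 1 1 1 c k) = lam • c k := by
  classical
  by_cases hk0 : k = 0
  · subst hk0; rw [hc0]; simp
  obtain ⟨O, hkO⟩ : ∃ O : Orbit, k ∈ O.1 := ⟨toOrbit k hk0, mem_sgnOrbit_self k⟩
  -- (s1) on the neighbours of the orbit, `c` agrees with the finite combination over `nbrIdx`
  have hcG : ∀ k' ∈ O.1, ∀ s ∈ Torus.abcFreq,
      c (k' - s) = (∑ j ∈ ((nbrOrbits O).sigma (fun O' => (Finset.univ : Finset (Fin (odim O')))) : Finset Idx),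
        w j • bfam j) (k' - s) :=
    fun k' hk' s hs => neighbour_value c w hc hc0 O hk' hs
  -- (s2) hence `X c = X G` on the orbit
  have hXG : crossForm 1 1 1 c k = crossForm 1 1 1
      (∑ j ∈ ((nbrOrbits O).sigma (fun O' => (Finset.univ : Finset (Fin (odim O')))) : Finset Idx), w j • bfam j) k := by
    have h0 : crossForm 1 1 1 (c - ∑ j ∈ ((nbrOrbits O).sigma (fun O' => (Finset.univ : Finset (Fin (odim O')))) : Finset Idx),
        w j • bfam j) k = 0 :=
      AbcLatticeLocality.crossForm_eq_zero_of_neighbours 1 1 1 _ k fun s hs => by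
        rw [Pi.sub_apply, hcG k hkO s hs, sub_self]
    have h1 := crossForm_add 1 1 1 (∑ j ∈ ((nbrOrbits O).sigma (fun O' => (Finset.univ : Finset (Fin (odim O')))) : Finset Idx),
      w j • bfam j) (c - ∑ j ∈ ((nbrOrbits O).sigma (fun O' => (Finset.univ : Finset (Fin (odim O')))) : Finset Idx),
      w j • bfam j) k
    rw [add_sub_cancel, h0, add_zero] at h1
    exact h1
  -- (s3)–(s5) the residual on the orbit vanishes
  have hres := residual_eq_zero (R := R) lam w O hcoord k hkO
  -- (s6) read off
  rw [hXG, hc O k hkO, O.freqNormSq_eq hkO]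
  rw [Finset.sum_apply] at hres
  have e : ∀ a : Fin (odim O), (w ⟨O, a⟩ • bfam ⟨O, a⟩) k = w ⟨O, a⟩ • bfam ⟨O, a⟩ k := fun a => rfl
  simp only [e] at hres
  rw [eq_neg_of_add_eq_zero_right hres, sub_smul]
  abel

end Synthesis

end Summit.NavierStokesRegularity.FluidComputer.AbcClassI

end
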